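import Literature.NumberTheory.Weil1964.ArchMetaplecticSubgroup
import Literature.NumberTheory.Weil1964.ArchWeilDatumReindex
import HarnessLib

/-!
# The metaplectic group of the Schwartz model is functorial under relabelling of the coordinates

Topic `NumberTheory/Weil1964`; namespace `Literature.NumberTheory.Weil1964`.  Continuation of
`Literature.NumberTheory.Weil1964.ArchMetaplecticDoubleCover` / `…ArchMetaplecticSubgroup` (the group `Mp^𝓢(W) = MpS σ` of
Heisenberg-covariant topological automorphisms of `𝓢(ℝ^σ)` with unitary `L²`-lifts over `Sp(W)`, `W = ℝ^σ × ℝ^σ`;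
Folland's block `P(g) = Sp.follandP g`, the vacuum coefficient `C(x) = MpS.vac x`, the normalisation
`MpS.IsMetaplectic x : C(x)² det P(proj x) = 1`, the subgroup `Mp₂ σ` it generates) and of
`Literature.NumberTheory.Weil1964.ArchWeilDatumReindex` (for an index bijection `E : σ ≃ σ′`: the coordinate permutation
`reindexCLE E : ℝ^{σ′} ≃ ℝ^σ`, the transports `schwartzTransport`, `l2Reindex`, the symplectic homomorphism
`reindexSp E : Sp(σ′) →* Sp(σ)` of `ArchPlacePhaseHom`, and `rhoSD_reindexCLE`: transported Heisenberg operators are the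
native ones at the relabelled point).

WHAT IS PROVED (kernel only; no record, no `sorry`, no new `Prop`):

* §1 the Gaussian is permutation invariant (`schwartzTransport_reindexCLE_hermitePi_zero`) and so is the vacuum vector of
  `L²` (`l2Reindex_vacL2`);
* §2 **`MpS.reindex E : MpS σ′ →* MpS σ`** — `(g, S) ↦ (reindexSp E g, e_* S e_*⁻¹)`: a HOMOMORPHISM over `reindexSp E`
  (`proj_reindex`), acting by `schwartzTransport (reindexCLE E) ∘ S ∘ (…)⁻¹` (`reindex_apply`), with
  `reindex E.symm ∘ reindex E = id` (`reindex_symm_reindex`; so each `reindex E` is a group ISOMORPHISM, `reindexMulEquiv`),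
  fixing the unit scalars (`reindex_unitScalar`, `reindex_negOne`);
* §3 **the vacuum coefficient is invariant**: `C(reindex E x) = C(x)` (`vac_reindex`);
* §4 **Folland's block is relabelled**: `P(reindexSp E g) = P(g).submatrix E E` (`Sp.follandP_reindexSp`), hence
  `det P(reindexSp E g) = det P(g)`;
* §5 **Folland's normalisation is invariant**: `IsMetaplectic (reindex E x) ↔ IsMetaplectic x`, and `reindex E` maps
  `Mp₂ σ′` into `Mp₂ σ` over `reindexSp E` (`reindex_mem_Mp₂`).

This is the relabelling invariance «la représentation standard … ne dépend que de la structure symplectique» of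
[Weil1964, Chap. I n° 12] / [Folland1989, §1.3 (1.25), §4.2 (4.23)] for the Schwartz-model metaplectic group; it is the
transport step of the pub-hodgecm2 literature fan-out row B08-2 (b) [Paul1998, §1.2 (1.2.1)], where the dual-pair embedding
`ι_V : U(V) → Sp(V ⊗ W)` is a block sum over an orthogonal basis of `W` only AFTER a relabelling of the tree's block
coordinates `DPIdx`.  Everything here is PROVED; citations record provenance only.

## References

* [Weil1964] A. Weil, *Sur certains groupes d'opérateurs unitaires*, Acta Math. 111 (1964) 143–211, Chap. I n° 12 p. 160.
* [Folland1989] G. B. Folland, *Harmonic Analysis in Phase Space*, Princeton UP 1989, §1.3 (1.25), §4.1 (4.11)–(4.16),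
  §4.2 (4.23), Thm. (4.37).
* [Paul1998] A. Paul, *Howe correspondence for real unitary groups*, J. Funct. Anal. 159 (1998) 384–431, §1.2 (1.2.1).
-/

set_option autoImplicit false

noncomputable section

open MeasureTheory Complex SchwartzMap
open scoped InnerProductSpace ComplexConjugate

namespace Literature.NumberTheory.Weil1964

open Literature.Analysis.SegalBargmann Literature.RepresentationTheory.HeisenbergGroup
open Literature.RepresentationTheory.KonnoKonno2007

variable {σ σ' : Type*} [Fintype σ] [DecidableEq σ] [Fintype σ'] [DecidableEq σ']

local notation "L2R" σ => Lp ℂ 2 (volume : Measure (σ → ℝ))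
local notation "SR" σ => SchwartzMap (σ → ℝ) ℂ
local notation "PV" σ => (σ → ℝ) × (σ → ℝ)
local notation "SpR" σ => symplecticGroup (polar (dotPairing σ))

/-! ## 1. The Gaussian and the vacuum vector are permutation invariant -/

/-- **The Gaussian `h₀` of `ℝ^{σ′}` relabelled along `E` is the Gaussian of `ℝ^σ`.** [cite: Folland1989, §1.7] -/
theorem schwartzTransport_reindexCLE_hermitePi_zero (E : σ ≃ σ') :
    schwartzTransport (reindexCLE E) (hermitePi (0 : σ' →₀ ℕ)) = hermitePi (0 : σ →₀ ℕ) := by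
  ext x
  rw [schwartzTransport_apply, hermitePi_apply, hermitePi_apply, herm_zero, herm_zero]
  simp only [hermiteFun, Literature.Analysis.SegalBargmann.vac, MvPolynomial.eval_C, gauss, vacCoef,
    Fintype.card_congr E]
  congr 3
  simp only [reindexCLE_symm_apply]
  exact Equiv.sum_comp E.symm (fun i => ((x i : ℝ) : ℂ) ^ 2)

/-- … and in the other direction. [cite: Folland1989, §1.7] -/
theorem schwartzTransport_reindexCLE_symm_hermitePi_zero (E : σ ≃ σ') :
    (schwartzTransport (reindexCLE E)).symm (hermitePi (0 : σ →₀ ℕ)) = hermitePi (0 : σ' →₀ ℕ) := by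
  rw [← schwartzTransport_reindexCLE_hermitePi_zero E, ContinuousLinearEquiv.symm_apply_apply]

/-- **The permutation unitary fixes the vacuum vector**: `l2Reindex E k₀ = k₀`. [cite: Folland1989, §1.7] -/
theorem l2Reindex_vacL2 (E : σ ≃ σ') : l2Reindex E (vacL2 : L2R σ') = (vacL2 : L2R σ) := by
  rw [← toL2_hermitePi_zero, ← toL2_schwartzTransport_reindexCLE, schwartzTransport_reindexCLE_hermitePi_zero,
    toL2_hermitePi_zero]

/-! ## 2. `Mp^𝓢` under relabelling: the homomorphism `MpS.reindex E : MpS σ′ →* MpS σ` -/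

namespace MpS

/-- Transport of a topological automorphism of `𝓢(ℝ^{σ′})` along the relabelling: `S ↦ e_* ∘ S ∘ e_*⁻¹`,
`e = reindexCLE E`. [cite: Folland1989, §1.3 (1.25)] -/
def reindexEquiv (E : σ ≃ σ') (S : (SR σ') ≃L[ℂ] SR σ') : (SR σ) ≃L[ℂ] SR σ :=
  ((schwartzTransport (reindexCLE E)).symm.trans S).trans (schwartzTransport (reindexCLE E))

omit [DecidableEq σ] [DecidableEq σ'] in
/-- Unfolding. [cite: Folland1989, §1.3 (1.25)] -/
@[simp] theorem reindexEquiv_apply (E : σ ≃ σ') (S : (SR σ') ≃L[ℂ] SR σ') (f : SR σ) :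
    reindexEquiv E S f = schwartzTransport (reindexCLE E) (S ((schwartzTransport (reindexCLE E)).symm f)) := rfl

omit [DecidableEq σ] [DecidableEq σ'] in
/-- As a linear map, `reindexEquiv E S` is `opTransport (reindexCLE E) S`. [cite: Folland1989, §1.3 (1.25)] -/
theorem coe_reindexEquiv (E : σ ≃ σ') (S : (SR σ') ≃L[ℂ] SR σ') :
    ((reindexEquiv E S : (SR σ) →L[ℂ] SR σ) : (SR σ) →ₗ[ℂ] SR σ) =
      opTransport (reindexCLE E) ((S : (SR σ') →L[ℂ] SR σ') : (SR σ') →ₗ[ℂ] SR σ') :=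
  LinearMap.ext fun _ => rfl

omit [DecidableEq σ] [DecidableEq σ'] in
/-- **The transported pair lies in `Mp^𝓢(ℝ^σ × ℝ^σ)`**: `e_* S e_*⁻¹` is Heisenberg-covariant over `reindexSp E g`
(`rhoSD_reindexCLE`) and is the restriction of the unitary `l2Reindex ∘ U ∘ l2Reindex⁻¹`.
[cite: Folland1989, §1.3 (1.25), §4.2 (4.23); Weil1964, Chap. I n° 12] -/
theorem reindex_mem (E : σ ≃ σ') (x : MpS σ') :
    ((reindexSp E (proj x), reindexEquiv E x.1.2) : (SpR σ) × ((SR σ) ≃L[ℂ] SR σ)) ∈ MpS σ := by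
  obtain ⟨hcov, U, hU⟩ := (mem_iff_covariant x.1).1 x.2
  refine (mem_iff_covariant _).2 ⟨fun p q f => ?_, ?_⟩
  · show reindexEquiv E x.1.2 (rhoS p q f) = _
    rw [reindexEquiv_apply, reindexEquiv_apply, schwartzTransport_symm_rhoS, rhoSD_reindexCLE,
      show (x.1.2 : (SR σ') → SR σ') = x.1.2 from rfl, hcov, coe_reindexSp_apply]
    simp only [reindexPV_apply, reindexPV_symm_apply, proj_apply]
    rw [← schwartzTransport_reindexCLE_rhoS]
    simp only [Function.comp_def, Equiv.apply_symm_apply]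
  · refine ⟨((l2Reindex E).symm.trans U).trans (l2Reindex E), ?_⟩
    rw [coe_reindexEquiv]
    exact liftsTo_opTransport_reindex E hU _ fun g => by simp

/-- **`MpS.reindex E : Mp^𝓢(ℝ^{σ′} × ℝ^{σ′}) →* Mp^𝓢(ℝ^σ × ℝ^σ)`**, `(g, S) ↦ (reindexSp E g, e_* S e_*⁻¹)` — the
metaplectic group of the Schwartz model is functorial under relabelling of the coordinates.
[cite: Weil1964, Chap. I n° 12, p. 160; Folland1989, §1.3 (1.25), §4.2 (4.23)] -/
def reindex (E : σ ≃ σ') : MpS σ' →* MpS σ where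
  toFun x := ⟨(reindexSp E (proj x), reindexEquiv E x.1.2), reindex_mem E x⟩
  map_one' := by
    refine ext' ?_ fun f => ?_
    · show reindexSp E (proj 1) = proj 1
      simp only [map_one]
    · show reindexEquiv E (1 : MpS σ').1.2 f = f
      rw [reindexEquiv_apply]
      exact (schwartzTransport (reindexCLE E)).apply_symm_apply f
  map_mul' x y := by
    refine ext' ?_ fun f => ?_
    · change reindexSp E (proj (x * y)) = proj (_ * _)
      rw [map_mul proj, map_mul, map_mul]
      rfl
    · show reindexEquiv E (x * y).1.2 f = reindexEquiv E x.1.2 (reindexEquiv E y.1.2 f)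
      simp only [reindexEquiv_apply, ContinuousLinearEquiv.symm_apply_apply]
      rfl

omit [DecidableEq σ] [DecidableEq σ'] in
/-- `reindex E x` lies over `reindexSp E (proj x)`. [cite: Weil1964, Chap. I n° 12, p. 160] -/
@[simp] theorem proj_reindex (E : σ ≃ σ') (x : MpS σ') : proj (reindex E x) = reindexSp E (proj x) := rfl

omit [DecidableEq σ] [DecidableEq σ'] in
/-- `proj ∘ reindex E = reindexSp E ∘ proj`. [cite: Weil1964, Chap. I n° 12, p. 160] -/
theorem proj_comp_reindex (E : σ ≃ σ') : proj.comp (reindex E) = (reindexSp E).comp (proj (σ := σ')) := rfl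

omit [DecidableEq σ] [DecidableEq σ'] in
/-- `reindex E x` acts by `e_* ∘ S ∘ e_*⁻¹`. [cite: Folland1989, §1.3 (1.25)] -/
theorem reindex_apply (E : σ ≃ σ') (x : MpS σ') (f : SR σ) :
    (reindex E x).1.2 f = schwartzTransport (reindexCLE E) (x.1.2 ((schwartzTransport (reindexCLE E)).symm f)) := rfl

omit [DecidableEq σ] [DecidableEq σ'] in
/-- `reindex E x` on a relabelled vector: `(reindex E x) (e_* f) = e_* (x f)`. [cite: Folland1989, §1.3 (1.25)] -/
theorem reindex_apply_schwartzTransport (E : σ ≃ σ') (x : MpS σ') (f : SR σ') :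
    (reindex E x).1.2 (schwartzTransport (reindexCLE E) f) = schwartzTransport (reindexCLE E) (x.1.2 f) := by
  rw [reindex_apply, ContinuousLinearEquiv.symm_apply_apply]

omit [DecidableEq σ] [DecidableEq σ'] in
/-- two successive relabellings of a Schwartz function: `(f ∘ E⁻¹_*) ∘ E_* = f`. [cite: Folland1989, §1.3 (1.25)] -/
theorem schwartzTransport_reindexCLE_symm_symm (E : σ ≃ σ') (f : SR σ') :
    (schwartzTransport (reindexCLE E.symm)).symm f = schwartzTransport (reindexCLE E) f := by
  ext x
  simp only [schwartzTransport_symm_apply, schwartzTransport_apply]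
  rfl

omit [DecidableEq σ] [DecidableEq σ'] in
/-- … and `E_* (E⁻¹_* f) = f`. [cite: Folland1989, §1.3 (1.25)] -/
theorem schwartzTransport_reindexCLE_symm_comp (E : σ ≃ σ') (f : SR σ') :
    schwartzTransport (reindexCLE E.symm) (schwartzTransport (reindexCLE E) f) = f := by
  ext x
  simp only [schwartzTransport_apply]
  congr 1
  funext j
  simp only [reindexCLE_symm_apply, Equiv.symm_symm, Equiv.apply_symm_apply]

omit [DecidableEq σ] [DecidableEq σ'] in
/-- two successive relabellings of a symplectic map: `reindexSp E⁻¹ (reindexSp E g) = g`. [cite: Weil1964, Chap. I n° 12, p. 160] -/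
theorem reindexSp_symm_reindexSp (E : σ ≃ σ') (g : SpR σ') : reindexSp E.symm (reindexSp E g) = g := by
  apply Subtype.ext
  apply LinearEquiv.ext
  intro w
  rw [coe_reindexSp_apply, coe_reindexSp_apply]
  simp only [reindexPV_apply, reindexPV_symm_apply, Equiv.symm_symm, Function.comp_def, Equiv.apply_symm_apply,
    Prod.mk.eta]

omit [DecidableEq σ] [DecidableEq σ'] in
/-- **`reindex E⁻¹ ∘ reindex E = id`.** [cite: Weil1964, Chap. I n° 12, p. 160] -/
@[simp] theorem reindex_symm_reindex (E : σ ≃ σ') (x : MpS σ') : reindex E.symm (reindex E x) = x := by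
  refine ext' ?_ fun f => ?_
  · rw [proj_reindex, proj_reindex, reindexSp_symm_reindexSp]
  · rw [reindex_apply, schwartzTransport_reindexCLE_symm_symm, reindex_apply_schwartzTransport,
      schwartzTransport_reindexCLE_symm_comp]

omit [DecidableEq σ] [DecidableEq σ'] in
/-- **`reindex E ∘ reindex E⁻¹ = id`.** [cite: Weil1964, Chap. I n° 12, p. 160] -/
@[simp] theorem reindex_reindex_symm (E : σ ≃ σ') (x : MpS σ) : reindex E (reindex E.symm x) = x := by
  simpa only [Equiv.symm_symm] using reindex_symm_reindex E.symm x

/-- **`reindex E` is a group isomorphism `Mp^𝓢(ℝ^{σ′} × ℝ^{σ′}) ≃* Mp^𝓢(ℝ^σ × ℝ^σ)`** with inverse `reindex E⁻¹`.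
[cite: Weil1964, Chap. I n° 12, p. 160] -/
def reindexMulEquiv (E : σ ≃ σ') : MpS σ' ≃* MpS σ :=
  { reindex E with
    invFun := reindex E.symm
    left_inv := reindex_symm_reindex E
    right_inv := reindex_reindex_symm E }

omit [DecidableEq σ] [DecidableEq σ'] in
/-- unfolding. [cite: Weil1964, Chap. I n° 12, p. 160] -/
@[simp] theorem reindexMulEquiv_apply (E : σ ≃ σ') (x : MpS σ') : reindexMulEquiv E x = reindex E x := rfl

omit [DecidableEq σ] [DecidableEq σ'] in
/-- `reindex E` is injective. [cite: Weil1964, Chap. I n° 12, p. 160] -/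
theorem reindex_injective (E : σ ≃ σ') : Function.Injective (reindex E) := (reindexMulEquiv E).injective

omit [DecidableEq σ] [DecidableEq σ'] in
/-- `reindex E` is surjective. [cite: Weil1964, Chap. I n° 12, p. 160] -/
theorem reindex_surjective (E : σ ≃ σ') : Function.Surjective (reindex E) := (reindexMulEquiv E).surjective

omit [DecidableEq σ] [DecidableEq σ'] in
/-- **Relabelling fixes the unit scalars**: `reindex E (c · 1) = c · 1`. [cite: Folland1989, §1.3 (1.25), §4.2 (4.23)] -/
@[simp] theorem reindex_unitScalar (E : σ ≃ σ') (c : ℂ) (hc : ‖c‖ = 1) :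
    reindex E (unitScalar c hc) = unitScalar c hc := by
  refine ext' ?_ fun f => ?_
  · rw [proj_reindex, proj_unitScalar, proj_unitScalar, map_one]
  · rw [reindex_apply, unitScalar_apply, unitScalar_apply, map_smul, ContinuousLinearEquiv.apply_symm_apply]

omit [DecidableEq σ] [DecidableEq σ'] in
/-- in particular `reindex E (−1) = −1`. [cite: Folland1989, §4.2 (4.23), Thm. (4.37)] -/
@[simp] theorem reindex_negOne (E : σ ≃ σ') : reindex E (negOne : MpS σ') = negOne := reindex_unitScalar E _ _

omit [DecidableEq σ] [DecidableEq σ'] in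
/-- `reindex E (−x) = −(reindex E x)`. [cite: Folland1989, §4.2 (4.23), Thm. (4.37)] -/
theorem reindex_negOne_mul (E : σ ≃ σ') (x : MpS σ') : reindex E (negOne * x) = negOne * reindex E x := by
  rw [map_mul, reindex_negOne]

/-! ## 3. The vacuum coefficient is invariant under relabelling -/

/-- **`C(reindex E x) = C(x)`**: the Gaussian and the vacuum vector are permutation invariant and `l2Reindex E` is unitary.
[cite: Folland1989, §4.2 Thm. (4.37); Weil1964, Chap. I n° 12] -/
@[simp] theorem vac_reindex (E : σ ≃ σ') (x : MpS σ') : vac (reindex E x) = vac x := by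
  rw [vac_apply, vac_apply, reindex_apply, schwartzTransport_reindexCLE_symm_hermitePi_zero,
    toL2_schwartzTransport_reindexCLE, ← l2Reindex_vacL2 E, LinearIsometryEquiv.inner_map_map]

end MpS

/-! ## 4. Folland's block `P` under relabelling -/

namespace Sp

omit [Fintype σ] [Fintype σ'] in
/-- a basis vector relabelled: `e_j ∘ E⁻¹ = e_{E j}`. [folklore] -/
private theorem single_comp_equiv_symm (E : σ ≃ σ') (j : σ) (c : ℝ) :
    (Pi.single j c : σ → ℝ) ∘ E.symm = Pi.single (E j) c := by
  funext k
  simp only [Function.comp_apply, Pi.single_apply, Equiv.symm_apply_eq]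

omit [Fintype σ] [Fintype σ'] [DecidableEq σ] [DecidableEq σ'] in
/-- the zero vector relabelled. [folklore] -/
private theorem zero_comp_equiv_symm (E : σ ≃ σ') : ((0 : σ → ℝ) ∘ E.symm : σ' → ℝ) = 0 := rfl

/-- the block `A` of `reindexSp E g` has matrix `(matrix of A(g)).submatrix E E`. [cite: Folland1989, §4.1 Prop. (4.1)] -/
theorem toMatrix'_blockA_reindexSp (E : σ ≃ σ') (g : SpR σ') :
    LinearMap.toMatrix' (blockA (reindexSp E g)) = (LinearMap.toMatrix' (blockA g)).submatrix E E := by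
  ext i j
  rw [Matrix.submatrix_apply, LinearMap.toMatrix'_apply, LinearMap.toMatrix'_apply, blockA_apply, blockA_apply,
    coe_reindexSp_apply]
  simp only [reindexPV_apply, reindexPV_symm_apply, Function.comp_apply, single_comp_equiv_symm,
    zero_comp_equiv_symm]

/-- the block `B` of `reindexSp E g`. [cite: Folland1989, §4.1 Prop. (4.1)] -/
theorem toMatrix'_blockB_reindexSp (E : σ ≃ σ') (g : SpR σ') :
    LinearMap.toMatrix' (blockB (reindexSp E g)) = (LinearMap.toMatrix' (blockB g)).submatrix E E := by
  ext i j
  rw [Matrix.submatrix_apply, LinearMap.toMatrix'_apply, LinearMap.toMatrix'_apply, blockB_apply, blockB_apply,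
    coe_reindexSp_apply]
  simp only [reindexPV_apply, reindexPV_symm_apply, Function.comp_apply, single_comp_equiv_symm,
    zero_comp_equiv_symm]

/-- the block `C` of `reindexSp E g`. [cite: Folland1989, §4.1 Prop. (4.1)] -/
theorem toMatrix'_blockC_reindexSp (E : σ ≃ σ') (g : SpR σ') :
    LinearMap.toMatrix' (blockC (reindexSp E g)) = (LinearMap.toMatrix' (blockC g)).submatrix E E := by
  ext i j
  rw [Matrix.submatrix_apply, LinearMap.toMatrix'_apply, LinearMap.toMatrix'_apply, blockC_apply, blockC_apply,
    coe_reindexSp_apply]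
  simp only [reindexPV_apply, reindexPV_symm_apply, Function.comp_apply, single_comp_equiv_symm,
    zero_comp_equiv_symm]

/-- the block `D` of `reindexSp E g`. [cite: Folland1989, §4.1 Prop. (4.1)] -/
theorem toMatrix'_blockD_reindexSp (E : σ ≃ σ') (g : SpR σ') :
    LinearMap.toMatrix' (blockD (reindexSp E g)) = (LinearMap.toMatrix' (blockD g)).submatrix E E := by
  ext i j
  rw [Matrix.submatrix_apply, LinearMap.toMatrix'_apply, LinearMap.toMatrix'_apply, blockD_apply, blockD_apply,
    coe_reindexSp_apply]
  simp only [reindexPV_apply, reindexPV_symm_apply, Function.comp_apply, single_comp_equiv_symm,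
    zero_comp_equiv_symm]

/-- **`P(reindexSp E g) = P(g).submatrix E E`** — Folland's complex block of a relabelled symplectic map is the
relabelled block. [cite: Folland1989, §4.1 (4.11)–(4.16)] -/
theorem follandP_reindexSp (E : σ ≃ σ') (g : SpR σ') : follandP (reindexSp E g) = (follandP g).submatrix E E := by
  simp only [follandP, map_add, map_sub, toMatrix'_blockA_reindexSp, toMatrix'_blockB_reindexSp,
    toMatrix'_blockC_reindexSp, toMatrix'_blockD_reindexSp]
  ext i j
  simp only [Matrix.add_apply, Matrix.sub_apply, Matrix.smul_apply, RingHom.mapMatrix_apply, Matrix.map_apply,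
    Matrix.submatrix_apply]

/-- **`det P(reindexSp E g) = det P(g)`.** [cite: Folland1989, §4.1 (4.11)–(4.16)] -/
@[simp] theorem det_follandP_reindexSp (E : σ ≃ σ') (g : SpR σ') :
    (follandP (reindexSp E g)).det = (follandP g).det := by
  rw [follandP_reindexSp, Matrix.det_submatrix_equiv_self]

end Sp

/-! ## 5. Folland's normalisation and `Mp₂` under relabelling -/

namespace MpS

/-- **`IsMetaplectic (reindex E x) ↔ IsMetaplectic x`**: both the vacuum coefficient and `det P` are invariant.
[cite: Folland1989, §4.2 Thm. (4.37); Weil1964, Chap. I n° 12] -/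
@[simp] theorem isMetaplectic_reindex_iff (E : σ ≃ σ') (x : MpS σ') :
    IsMetaplectic (reindex E x) ↔ IsMetaplectic x := by
  rw [isMetaplectic_iff, isMetaplectic_iff, vac_reindex, proj_reindex, Sp.det_follandP_reindexSp]

/-- forward direction as a named lemma. [cite: Folland1989, §4.2 Thm. (4.37)] -/
theorem IsMetaplectic.reindex (E : σ ≃ σ') {x : MpS σ'} (hx : IsMetaplectic x) : IsMetaplectic (reindex E x) :=
  (isMetaplectic_reindex_iff E x).2 hx

/-- **`reindex E` maps `Mp₂(ℝ^{σ′} × ℝ^{σ′})` into `Mp₂(ℝ^σ × ℝ^σ)`** (it maps the generating metaplectic elements to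
metaplectic elements). [cite: Folland1989, §4.2 Thm. (4.37); Weil1964, Chap. I n° 12] -/
theorem reindex_mem_Mp₂ (E : σ ≃ σ') {x : MpS σ'} (hx : x ∈ Mp₂ σ') : reindex E x ∈ Mp₂ σ := by
  have h : (Mp₂ σ').map (reindex E) ≤ Mp₂ σ := by
    rw [Mp₂, MonoidHom.map_closure]
    exact Subgroup.closure_le _ |>.2 fun y ⟨x, hx, hxy⟩ => hxy ▸ Mp₂.mem_of_isMetaplectic (IsMetaplectic.reindex E hx)
  exact h ⟨x, hx, rfl⟩

/-- `Mp₂.map (reindex E) = Mp₂`: the relabelling isomorphism carries `Mp₂(W′)` ONTO `Mp₂(W)`. [cite: Folland1989, §4.2 Thm. (4.37)] -/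
theorem map_reindex_Mp₂ (E : σ ≃ σ') : (Mp₂ σ').map (reindex E) = Mp₂ σ := by
  refine le_antisymm (fun y ⟨x, hx, hxy⟩ => hxy ▸ reindex_mem_Mp₂ E hx) fun y hy => ?_
  exact ⟨reindex E.symm y, reindex_mem_Mp₂ E.symm hy, reindex_reindex_symm E y⟩

/-- **`Mp₂.reindex E : Mp₂(ℝ^{σ′} × ℝ^{σ′}) →* Mp₂(ℝ^σ × ℝ^σ)`**, the restriction of `MpS.reindex E`, over `reindexSp E`
and fixing `ε`. [cite: Folland1989, §4.2 Thm. (4.37); Weil1964, Chap. I n° 12] -/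
def Mp₂.reindex (E : σ ≃ σ') : Mp₂ σ' →* Mp₂ σ :=
  ((MpS.reindex E).comp (Mp₂ σ').subtype).codRestrict (Mp₂ σ) fun x => reindex_mem_Mp₂ E x.2

/-- unfolding. [cite: Folland1989, §4.2 Thm. (4.37)] -/
@[simp] theorem Mp₂.coe_reindex (E : σ ≃ σ') (x : Mp₂ σ') : (Mp₂.reindex E x : MpS σ) = MpS.reindex E x := rfl

/-- `pr (Mp₂.reindex E x) = reindexSp E (pr x)`. [cite: Weil1964, Chap. I n° 12] -/
@[simp] theorem Mp₂.pr_reindex (E : σ ≃ σ') (x : Mp₂ σ') : Mp₂.pr (Mp₂.reindex E x) = reindexSp E (Mp₂.pr x) := rfl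

/-- `Mp₂.reindex E ε = ε`. [cite: Folland1989, §4.2 Thm. (4.37)] -/
@[simp] theorem Mp₂.reindex_ε (E : σ ≃ σ') : Mp₂.reindex E (Mp₂.ε : Mp₂ σ') = Mp₂.ε :=
  Subtype.ext (reindex_negOne E)

end MpS

end Literature.NumberTheory.Weil1964

end
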